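import Mathlib
import Summits.ValiantsHypothesis.ValiantsHypothesis.Theorems.RefutationDegreeDefs
import Summits.ValiantsHypothesis.ValiantsHypothesis.Theorems.RefutationDegreeSosSound
import Literature.Computability.Complexity.NullstellensatzRefutation
import Literature.Computability.AlgebraicComplexity.DeterminantalComplexity

/-!
# Crux `RefutationDegree.BeyondHessianSos` (stmt-ValiantsHypothesis-5643), line `Sketch` —
# stub `stub_weakNS` (weak Nullstellensatz for Rep(n,m))

The qualitative half of the degree question for the system Rep(n,m) ("`per_n` is the determinant
of a size-`m` affine pencil"): if `per_n` has NO affine determinantal representation of size `m`,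
then the coefficient equations `{(defect n m).coeff μ = 0}_μ` in the unknowns `Unk n m` have a
Nullstellensatz refutation of SOME degree.

Proof (folklore).
1. No common zero: a point `a : Unk n m → ℂ` killing every equation makes the concrete matrix
   `A_a = (a₀ᵢⱼ + Σ_e aₑᵢⱼ x_e)ᵢⱼ` (the pencil base-changed along `eval a`,
   `RefutationDegreeSosSound.mapMatrix_eval_pencil`) an affine matrix with `det A_a = per_n`,
   since `map (eval a) (defect n m) = det A_a − per_n` has all coefficients `eval a (coeff μ) = 0`.
2. Hilbert's Nullstellensatz over `ℂ` (Mathlib `MvPolynomial.vanishingIdeal_zeroLocus_eq_radical`):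
   the zero locus of the ideal spanned by the equations is empty, so its radical is `⊤` and `1`
   lies in the ideal.
3. Membership in the span of a range is a finite combination
   (`Finsupp.mem_ideal_span_range_iff_exists_finsupp`); the degree bound is the maximum of the
   total degrees of the finitely many products.
-/

-- `Summit.ValiantsHypothesis.ValiantsHypothesis.…` is the tree's mandated single-conjunct layout
-- (Sub = Summit), so the duplicated namespace component is intended.
set_option linter.dupNamespace false

noncomputable section

open MvPolynomial

namespace Summit.ValiantsHypothesis.ValiantsHypothesis.Theorems.RefutationDegreeBeyondHessianSos

open Literature.Computability.AlgebraicComplexity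
open Literature.Computability.Complexity (HasNSRefutationOfDegree)
open Summit.ValiantsHypothesis.ValiantsHypothesis.Theorems.RefutationDegree

/-- The entries `a₀ᵢⱼ + Σ_e aₑᵢⱼ x_e` of a concrete affine pencil have total degree `≤ 1`. -/
theorem totalDegree_affine_entry_le_one {σ R : Type*} [CommSemiring R] [Fintype σ]
    (c : R) (b : σ → R) :
    (C c + ∑ e : σ, C (b e) * X e : MvPolynomial σ R).totalDegree ≤ 1 := by
  refine (totalDegree_add _ _).trans (max_le ?_ ?_)
  · rw [totalDegree_C]
    exact Nat.zero_le 1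
  · refine totalDegree_finsetSum_le fun e _ => ?_
    rw [C_mul_X_eq_monomial]
    refine (totalDegree_monomial_le _ _).trans ?_
    rw [Finsupp.sum_single_index rfl]
    exact le_rfl

/-- Base change of the defect along the evaluation of the unknowns at a point `a`:
`map (eval a) (det (pencil) − per_n) = det A_a − per_n` for the concrete affine matrix `A_a`. -/
theorem map_eval_defect (n m : ℕ) (a : Unk n m → ℂ) :
    MvPolynomial.map (eval a) (defect n m) =
      (Matrix.of fun i j : Fin m =>
          C (a (none, (i, j))) + ∑ e : Fin n × Fin n, C (a (some e, (i, j))) * X e).det -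
        perPoly (Fin n) ℂ := by
  unfold defect pencil
  rw [map_sub, RingHom.map_det, RefutationDegreeSosSound.mapMatrix_eval_pencil a, map_map]
  have hid : (eval a).comp (C : ℂ →+* MvPolynomial (Unk n m) ℂ) = RingHom.id ℂ := by
    ext r
    simp
  rw [hid, map_id]

/-- **No common zero.** A common complex zero `a` of the equations of Rep(n,m) is (the coefficient
point of) an affine determinantal representation of `per_n` of size `m`. -/
theorem hasDetRepr_of_common_zero (n m : ℕ) (a : Unk n m → ℂ)
    (ha : ∀ μ : (Fin n × Fin n) →₀ ℕ, eval a ((defect n m).coeff μ) = 0) :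
    HasDetRepr (perPoly (Fin n) ℂ) m := by
  refine ⟨Matrix.of fun i j : Fin m =>
      C (a (none, (i, j))) + ∑ e : Fin n × Fin n, C (a (some e, (i, j))) * X e, ?_, ?_⟩
  · intro i j
    rw [Matrix.of_apply]
    exact totalDegree_affine_entry_le_one _ _
  · have hzero : MvPolynomial.map (eval a) (defect n m) = 0 := by
      ext μ
      rw [coeff_map, coeff_zero]
      exact ha μ
    rw [map_eval_defect] at hzero
    exact sub_eq_zero.mp hzero

/-- **Weak Nullstellensatz for Rep(n,m).** If `per_n` has no affine determinantal representation of
size `m`, then `1` lies in the ideal of `ℂ[Unk n m]` spanned by the equations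
`(defect n m).coeff μ`. -/
theorem one_mem_span_coeff_defect (n m : ℕ) (h : ¬ HasDetRepr (perPoly (Fin n) ℂ) m) :
    (1 : MvPolynomial (Unk n m) ℂ) ∈
      Ideal.span (Set.range fun μ : (Fin n × Fin n) →₀ ℕ => (defect n m).coeff μ) := by
  set I : Ideal (MvPolynomial (Unk n m) ℂ) :=
    Ideal.span (Set.range fun μ : (Fin n × Fin n) →₀ ℕ => (defect n m).coeff μ) with hI
  have hz : zeroLocus ℂ I = ∅ := by
    rw [hI, zeroLocus_span]
    ext a
    simp only [Set.mem_setOf_eq, Set.mem_empty_iff_false, iff_false]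
    intro ha
    exact h (hasDetRepr_of_common_zero n m a fun μ => ha _ ⟨μ, rfl⟩)
  have hrad := vanishingIdeal_zeroLocus_eq_radical (k := ℂ) (K := ℂ) I
  rw [hz, vanishingIdeal_empty] at hrad
  rw [Ideal.radical_eq_top.mp hrad.symm]
  trivial

/-- **Stub `stub_weakNS`** (weak Nullstellensatz for Rep(n,m)). If `per_n` has no affine
determinantal representation of size `m`, then the system `{(defect n m).coeff μ = 0}_μ` of
coefficient equations of Rep(n,m), in the finitely many unknowns `Unk n m` over the algebraically
closed field `ℂ`, has a Nullstellensatz refutation of some degree: by Hilbert's Nullstellensatz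
`1` is a finite combination `Σ_{μ ∈ s} g μ · coeff μ` of the equations, and the degree is the
largest total degree of a product. -/
theorem stub_weakNS (n m : ℕ) (h : ¬ HasDetRepr (perPoly (Fin n) ℂ) m) :
    ∃ d : ℕ, HasNSRefutationOfDegree
      (fun μ : (Fin n × Fin n) →₀ ℕ => (defect n m).coeff μ) d := by
  obtain ⟨c, hc⟩ :=
    Finsupp.mem_ideal_span_range_iff_exists_finsupp.mp (one_mem_span_coeff_defect n m h)
  refine ⟨c.support.sup fun μ => (c μ * (defect n m).coeff μ).totalDegree, c.support,
    fun μ => c μ, hc, fun μ hμ => ?_⟩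
  exact Finset.le_sup (f := fun μ => (c μ * (defect n m).coeff μ).totalDegree) hμ

end Summit.ValiantsHypothesis.ValiantsHypothesis.Theorems.RefutationDegreeBeyondHessianSos

end
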